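import Literature.NumberTheory.EllipticCurves.NeronComponentIndex
import Literature.NumberTheory.EllipticCurves.NeronModelProofs
import Literature.NumberTheory.EllipticCurves.TamagawaSubgroupProofs
import Literature.NumberTheory.DiophantineGeometry.TateAlgorithmTranslationsProofs
import HarnessLib

/-!
# The local index for types `II` and `II*`: `c_v = 1` (proofs)

Sibling proof file of `NeronComponentIndex.lean`: discharge of the named facts
`Literature.NumberTheory.EllipticCurves.localTamagawaNumber_eq_one_of_kodairaSymbolAt_eq_II`
(Tate's algorithm, Step 3) and
`Literature.NumberTheory.EllipticCurves.localTamagawaNumber_eq_one_of_kodairaSymbolAt_eq_IIstar`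
(Step 10): if Tate's algorithm returns type `II` or `II*` at `v`, then every `K_v`-point of the
minimal model has nonsingular reduction, `E₀(K_v) = E(K_v)`, `c_v = 1` (Silverman, *ATAEC*,
IV.9.4, Steps 3 and 10, PDF pp. 344, 346: "`c = 1`").

## Proof (elementary; no Néron model)

Let `R` be a discrete valuation ring with perfect residue field, `V` a Weierstrass equation over
`R` and `(a, b) ∈ R²` a point of `V` whose reduction is *singular*. After the Step-2 translation
`C` (it exists over a perfect residue field) `C • V` has `a₃, a₄, a₆ ∈ 𝔪`, so `(0, 0)` is a
singular point of its reduction — the only one, by the identity `2f − x f_x − y f_y = x³` for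
`f = y² + a₁xy − x³ − a₂x²` (`LocalIndex.eq_zero_of_equation_of_not_nonsingular`); as
`R`-changes of variables commute with reduction and preserve singularity, the transported point
`(a', b')` lies in `𝔪 × 𝔪` (`LocalIndex.mem_maximalIdeal_of_not_nonsingular`).
* Type `II` (Step 3 fired: `π² ∤ a₆` on `C • V`): the equation at `(a', b')` gives `a₆ ∈ 𝔪²`,
  a contradiction (`LocalIndex.a₆_mem_sq_of_equation`; Silverman's Lemma IV.9.5(b)).
* Type `II*` (Step 10 fired): after the translations of Steps 2, 6, 8, 9 (all exist over a
  perfect residue field, `TateAlgorithmTranslationsProofs`) the model `D • V` has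
  `π ∣ a₁, π² ∣ a₂, π³ ∣ a₃, π⁴ ∣ a₄, π⁵ ∣ a₆, π⁶ ∤ a₆`; a point in `𝔪 × 𝔪` on it forces
  successively `π² ∣ y`, `π² ∣ x`, `π³ ∣ y`, `π⁶ ∣ a₆` — contradiction
  (`LocalIndex.dvd_of_equation_deep`, `LocalIndex.dvd_a₆_of_equation_IIstar`).

So every point has nonsingular reduction, `E₀(K) = E(K)`, and the index is `1`
(`LocalIndex.index_goodReductionSubgroup_eq_one`, through the `TamagawaSubgroupProofs` bridge).
The branch of the algorithm is read off the literal `if`-tree of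
`WeierstrassCurve.kodairaSymbolOfMinimal` (`LocalIndex.tateTree_ne_II`, `tateTree_eq_IIstar_iff`).

## References

* J. H. Silverman, *Advanced Topics in the Arithmetic of Elliptic Curves*, GTM 151, Springer
  1994, IV.9.4 Steps 2, 3, 10 (PDF pp. 344–346) and their proofs (PDF p. 347: "Hence
  `π ∣ a₃, a₄, a₆`"; Lemma 9.5(b)). [SilvermanATAEC1994]

Helpers live in the sub-namespace `Literature.NumberTheory.EllipticCurves.LocalIndex`.
-/

noncomputable section

open scoped Classical

open IsLocalRing

namespace Literature.NumberTheory.EllipticCurves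

namespace LocalIndex

open DiophantineGeometry DiophantineGeometry.TateAlgorithm

/-! ### The singular point of a Weierstrass cubic with `a₃ = a₄ = a₆ = 0` -/

/-- Over a field, if `a₃ = a₄ = a₆ = 0` then `(0, 0)` is the only singular point of the
Weierstrass cubic: for `f = y² + a₁xy + a₃y − x³ − a₂x² − a₄x − a₆` one has
`2f − x f_x − y f_y = x³ + a₃y − a₄x − 2a₆`, so at a singular point `x³ = 0`, then `y² = 0`.
[folklore] -/
theorem eq_zero_of_equation_of_not_nonsingular {F : Type*} [Field F] {W : WeierstrassCurve F}
    (h3 : W.a₃ = 0) (h4 : W.a₄ = 0) (h6 : W.a₆ = 0) {x y : F} (he : W.toAffine.Equation x y)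
    (hns : ¬ W.toAffine.Nonsingular x y) : x = 0 ∧ y = 0 := by
  rw [WeierstrassCurve.Affine.nonsingular_iff', not_and_or, not_or, not_ne_iff, not_ne_iff]
    at hns
  rcases hns with hns | ⟨hX, hY⟩
  · exact (hns he).elim
  rw [WeierstrassCurve.Affine.equation_iff] at he
  have hx3 : x ^ 3 = 0 := by
    linear_combination 2 * he - x * hX - y * hY - y * h3 + x * h4 + 2 * h6
  have hx : x = 0 := pow_eq_zero_iff (n := 3) (by norm_num) |>.mp hx3
  refine ⟨hx, ?_⟩
  subst hx
  have hy2 : y ^ 2 = 0 := by linear_combination he - y * h3 + h6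
  exact pow_eq_zero_iff (n := 2) (by norm_num) |>.mp hy2

variable {R : Type*} [CommRing R] [IsDomain R] [IsDiscreteValuationRing R]

/-- Over a discrete valuation ring: if `a₃, a₄, a₆ ∈ 𝔪` (the singular point of the reduction
is `(0, 0)`) then an `R`-point `(a, b)` with singular reduction has `a, b ∈ 𝔪`. [folklore] -/
theorem mem_maximalIdeal_of_not_nonsingular {V : WeierstrassCurve R}
    (h3 : V.a₃ ∈ maximalIdeal R) (h4 : V.a₄ ∈ maximalIdeal R) (h6 : V.a₆ ∈ maximalIdeal R)
    {a b : R} (he : V.toAffine.Equation a b)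
    (hns : ¬ (V.map (residue R)).toAffine.Nonsingular (residue R a) (residue R b)) :
    a ∈ maximalIdeal R ∧ b ∈ maximalIdeal R := by
  have he' : (V.map (residue R)).toAffine.Equation (residue R a) (residue R b) := he.map _
  obtain ⟨ha, hb⟩ := eq_zero_of_equation_of_not_nonsingular
    ((residue_eq_zero_iff _).mpr h3) ((residue_eq_zero_iff _).mpr h4)
    ((residue_eq_zero_iff _).mpr h6) he' hns
  exact ⟨(residue_eq_zero_iff _).mp ha, (residue_eq_zero_iff _).mp hb⟩

/-- If `a₃, a₄ ∈ 𝔪` and `(a, b) ∈ 𝔪 × 𝔪` lies on `V` then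
`a₆ = b² + a₁ab + a₃b − a³ − a₂a² − a₄a ∈ 𝔪²` (the computation behind Silverman, *ATAEC*,
Lemma IV.9.5(b), PDF p. 347). [folklore] -/
theorem a₆_mem_sq_of_equation {V : WeierstrassCurve R}
    (h3 : V.a₃ ∈ maximalIdeal R) (h4 : V.a₄ ∈ maximalIdeal R) {a b : R}
    (he : V.toAffine.Equation a b) (ha : a ∈ maximalIdeal R) (hb : b ∈ maximalIdeal R) :
    V.a₆ ∈ maximalIdeal R ^ 2 := by
  rw [WeierstrassCurve.Affine.equation_iff] at he
  have e : V.a₆ =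
      b * b + V.a₁ * (a * b) + V.a₃ * b - a * (a * a) - V.a₂ * (a * a) - V.a₄ * a := by
    linear_combination -he
  rw [e, pow_two]
  have hab : a * b ∈ maximalIdeal R * maximalIdeal R := Ideal.mul_mem_mul ha hb
  have haa : a * a ∈ maximalIdeal R * maximalIdeal R := Ideal.mul_mem_mul ha ha
  refine Ideal.sub_mem _ (Ideal.sub_mem _ (Ideal.sub_mem _ (Ideal.add_mem _ (Ideal.add_mem _
    (Ideal.mul_mem_mul hb hb) (Ideal.mul_mem_left _ _ hab)) (Ideal.mul_mem_mul h3 hb))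
    (Ideal.mul_mem_left _ _ haa)) (Ideal.mul_mem_left _ _ haa)) (Ideal.mul_mem_mul h4 ha)

/-- `toY` of a change of variables commutes with ring homomorphisms. [folklore] -/
theorem map_toY_ringHom {A B : Type*} [CommRing A] [CommRing B] (f : A →+* B)
    (C : WeierstrassCurve.VariableChange A) (x y : A) :
    f (C.toY x y) = (C.map f).toY (f x) (f y) := by
  simp only [WeierstrassCurve.VariableChange.toY_def, WeierstrassCurve.VariableChange.map,
    Units.coe_map_inv, MonoidHom.coe_coe, map_mul, map_pow, map_sub]

/-- Reduction commutes with `R`-changes of variables and preserves singularity: if the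
`R`-point `(a, b)` of `V` has singular reduction, so does its image `(C.toX a, C.toY a b)` on
`C • V` (`VariableChange.nonsingular_iff` over the residue field). [folklore] -/
theorem not_nonsingular_smul {V : WeierstrassCurve R} (C : WeierstrassCurve.VariableChange R)
    {a b : R} (hns : ¬ (V.map (residue R)).toAffine.Nonsingular (residue R a) (residue R b)) :
    ¬ ((C • V).map (residue R)).toAffine.Nonsingular (residue R (C.toX a))
      (residue R (C.toY a b)) := by
  rw [← WeierstrassCurve.map_variableChange, WeierstrassCurve.VariableChange.map_toX_ringHom,
    map_toY_ringHom, WeierstrassCurve.VariableChange.nonsingular_iff]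
  exact hns

/-- The part of Tate's tree after Step 3 never returns `II`. [folklore] -/
theorem tateTree_ne_II (p4 p5 p6 p7 p8 p9 p10 : Prop) [Decidable p4] [Decidable p5]
    [Decidable p6] [Decidable p7] [Decidable p8] [Decidable p9] [Decidable p10] (n : ℕ) :
    (if p4 then KodairaSymbol.III else if p5 then .IV else if p6 then .Istar 0
      else if p7 then .Istar n else if p8 then .IVstar else if p9 then .IIIstar
      else if p10 then .IIstar else .I 0) ≠ .II := by
  split_ifs <;> simp

/-- Tate's tree returns `II*` exactly when the first nine tests fail and the tenth fires.
[folklore] -/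
theorem tateTree_eq_IIstar_iff (p1 p2 p3 p4 p5 p6 p7 p8 p9 p10 : Prop) [Decidable p1]
    [Decidable p2] [Decidable p3] [Decidable p4] [Decidable p5] [Decidable p6] [Decidable p7]
    [Decidable p8] [Decidable p9] [Decidable p10] (n m : ℕ) :
    (if p1 then KodairaSymbol.I 0 else if p2 then .I n else if p3 then .II else if p4 then .III
      else if p5 then .IV else if p6 then .Istar 0 else if p7 then .Istar m
      else if p8 then .IVstar else if p9 then .IIIstar else if p10 then .IIstar else .I 0) =
        .IIstar ↔ ¬ p1 ∧ ¬ p2 ∧ ¬ p3 ∧ ¬ p4 ∧ ¬ p5 ∧ ¬ p6 ∧ ¬ p7 ∧ ¬ p8 ∧ ¬ p9 ∧ p10 := by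
  split_ifs <;> simp [*]

/-- **Step 3 fired.** If `kodairaSymbolOfMinimal V = II` then `π ∣ Δ`, and on the Step-2 model
`π ∣ b₂`, `π² ∤ a₆`. [folklore] -/
theorem kodairaSymbolOfMinimal_eq_II_imp (V : WeierstrassCurve R)
    (h : V.kodairaSymbolOfMinimal = .II) :
    V.Δ ∈ maximalIdeal R ∧ (normalizeStep2 V).b₂ ∈ maximalIdeal R ∧
      (normalizeStep2 V).a₆ ∉ maximalIdeal R ^ 2 := by
  unfold WeierstrassCurve.kodairaSymbolOfMinimal at h
  dsimp only at h
  by_cases h1 : V.Δ ∈ maximalIdeal R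
  swap
  · rw [if_pos h1] at h; simp at h
  rw [if_neg (not_not.mpr h1)] at h
  by_cases h2 : (normalizeStep2 V).b₂ ∈ maximalIdeal R
  swap
  · rw [if_pos h2] at h; simp at h
  rw [if_neg (not_not.mpr h2)] at h
  by_cases h3 : (normalizeStep2 V).a₆ ∈ maximalIdeal R ^ 2
  · rw [if_neg (not_not.mpr h3)] at h
    exact absurd h (tateTree_ne_II _ _ _ _ _ _ _ _)
  · exact ⟨h1, h2, h3⟩

/-- **Step 10 fired.** `kodairaSymbolOfMinimal V = II*` iff the tests of Steps 1–9 fail on the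
successive normalised models and `π⁶ ∤ a₆` on the Step-9 model. [folklore] -/
theorem kodairaSymbolOfMinimal_eq_IIstar_iff (V : WeierstrassCurve R) :
    V.kodairaSymbolOfMinimal = .IIstar ↔
      ¬ V.Δ ∉ maximalIdeal R ∧ ¬ (normalizeStep2 V).b₂ ∉ maximalIdeal R ∧
      ¬ (normalizeStep2 V).a₆ ∉ maximalIdeal R ^ 2 ∧
      ¬ (normalizeStep2 V).b₈ ∉ maximalIdeal R ^ 3 ∧
      ¬ (normalizeStep2 V).b₆ ∉ maximalIdeal R ^ 3 ∧
      ¬ distinctRootCount (cubicStep6 (normalizeStep6 (normalizeStep2 V))) = 3 ∧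
      ¬ distinctRootCount (cubicStep6 (normalizeStep6 (normalizeStep2 V))) = 2 ∧
      ¬ distinctRootCount
          (quadraticStep8 (normalizeStep8 (normalizeStep6 (normalizeStep2 V)))) = 2 ∧
      ¬ (normalizeStep9 (normalizeStep8 (normalizeStep6 (normalizeStep2 V)))).a₄ ∉
          maximalIdeal R ^ 4 ∧
      (normalizeStep9 (normalizeStep8 (normalizeStep6 (normalizeStep2 V)))).a₆ ∉
          maximalIdeal R ^ 6 := by
  unfold WeierstrassCurve.kodairaSymbolOfMinimal
  exact tateTree_eq_IIstar_iff _ _ _ _ _ _ _ _ _ _ _ _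

/-- **The Step-10 model.** Over a perfect residue field, if Tate's algorithm returns `II*` then
some `R`-model `D • V` has `π ∣ a₁`, `π² ∣ a₂`, `π³ ∣ a₃`, `π⁴ ∣ a₄`, `π⁵ ∣ a₆` and `π⁶ ∤ a₆`
(the translations of Steps 2, 6, 8, 9 exist; Silverman, *ATAEC*, IV.9.4 Steps 6–10,
PDF pp. 344–346). [cite: SilvermanATAEC1994, IV.9.4 Steps 6–10] -/
theorem exists_smul_of_kodairaSymbolOfMinimal_eq_IIstar [PerfectField (ResidueField R)]
    (V : WeierstrassCurve R) (hV : V.kodairaSymbolOfMinimal = .IIstar) :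
    ∃ D : WeierstrassCurve.VariableChange R,
      (D • V).a₁ ∈ maximalIdeal R ∧ (D • V).a₂ ∈ maximalIdeal R ^ 2 ∧
      (D • V).a₃ ∈ maximalIdeal R ^ 3 ∧ (D • V).a₄ ∈ maximalIdeal R ^ 4 ∧
      (D • V).a₆ ∈ maximalIdeal R ^ 5 ∧ (D • V).a₆ ∉ maximalIdeal R ^ 6 := by
  obtain ⟨h1, h2, h3, h4, h5, h6t, h7t, h8t, h9t, h10t⟩ :=
    (kodairaSymbolOfMinimal_eq_IIstar_iff V).mp hV
  rw [not_not] at h1 h2 h3 h4 h5 h9t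
  -- Step 2
  have hex2 := exists_variableChange_step2_of_perfectField V h1
  have hN2 : normalizeStep2 V = hex2.choose • V := dif_pos hex2
  obtain ⟨-, hA₃, hA₄, -⟩ := hex2.choose_spec
  rw [hN2] at h2 h3 h4 h5 h6t h7t h8t h9t h10t
  -- Step 6
  have hex6 := exists_variableChange_step6_of_perfectField h2 hA₃ hA₄ h3 h5 h4
  have hN6 : normalizeStep6 (hex2.choose • V) = hex6.choose • (hex2.choose • V) := dif_pos hex6
  obtain ⟨-, hB₁, hB₂, hB₃, hB₄, hB₆⟩ := hex6.choose_spec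
  rw [hN6] at h6t h7t h8t h9t h10t
  -- Step 8
  have hex8 := exists_variableChange_step8_of_perfectField hB₁ hB₂ hB₃ hB₄ hB₆ h6t h7t
  have hN8 : normalizeStep8 (hex6.choose • (hex2.choose • V)) =
      hex8.choose • (hex6.choose • (hex2.choose • V)) := dif_pos hex8
  obtain ⟨-, hD₁, hD₂, hD₃, hD₄, hD₆⟩ := hex8.choose_spec
  rw [hN8] at h8t h9t h10t
  -- Step 9
  have hex9 := exists_variableChange_step9_of_perfectField hD₁ hD₂ hD₃ hD₄ hD₆ h8t
  have hN9 : normalizeStep9 (hex8.choose • (hex6.choose • (hex2.choose • V))) =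
      hex9.choose • (hex8.choose • (hex6.choose • (hex2.choose • V))) := dif_pos hex9
  obtain ⟨-, hE₁, hE₂, hE₃, -, hE₆⟩ := hex9.choose_spec
  rw [hN9] at h9t h10t
  refine ⟨hex9.choose * hex8.choose * hex6.choose * hex2.choose, ?_⟩
  simp only [mul_smul]
  exact ⟨hE₁, hE₂, hE₃, h9t, hE₆, h10t⟩

/-- **Descent of a point reducing to the cusp, deep case.** If `π ∣ a₁`, `π² ∣ a₂`, `π³ ∣ a₃`,
`π³ ∣ a₄`, `π⁵ ∣ a₆` and `(x, y) ∈ 𝔪 × 𝔪` lies on the curve, then `π² ∣ x` and `π³ ∣ y` (the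
equation divided by `π²`, `π³`, `π⁴` exhibits successively `π² ∣ y`, `π² ∣ x`, `π³ ∣ y`). Used
for types `II*` (below) and `III*`. [folklore] -/
theorem dvd_of_equation_deep {ϖ : R} (hϖ : Irreducible ϖ) {V : WeierstrassCurve R}
    (h1 : ϖ ∣ V.a₁) (h2 : ϖ ^ 2 ∣ V.a₂) (h3 : ϖ ^ 3 ∣ V.a₃) (h4 : ϖ ^ 3 ∣ V.a₄)
    (h6 : ϖ ^ 5 ∣ V.a₆) {x y : R} (he : V.toAffine.Equation x y) (hx : ϖ ∣ x) (hy : ϖ ∣ y) :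
    ϖ ^ 2 ∣ x ∧ ϖ ^ 3 ∣ y := by
  have hϖ0 : ϖ ≠ 0 := hϖ.ne_zero
  have hp := hϖ.prime
  obtain ⟨α, hα⟩ := h1
  obtain ⟨β, hβ⟩ := h2
  obtain ⟨γ, hγ⟩ := h3
  obtain ⟨δ, hδ⟩ := h4
  obtain ⟨ε, hε⟩ := h6
  obtain ⟨x₁, rfl⟩ := hx
  obtain ⟨y₁, rfl⟩ := hy
  rw [WeierstrassCurve.Affine.equation_iff] at he
  simp only [hα, hβ, hγ, hδ, hε] at he
  have hy₁ : ϖ ∣ y₁ := by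
    refine hp.dvd_of_dvd_pow (n := 2) ((mul_dvd_mul_iff_left (pow_ne_zero 2 hϖ0)).mp ?_)
    exact ⟨x₁ ^ 3 + ϖ * β * x₁ ^ 2 + ϖ * δ * x₁ + ϖ ^ 2 * ε - α * x₁ * y₁ - ϖ * γ * y₁,
      by linear_combination he⟩
  obtain ⟨y₂, rfl⟩ := hy₁
  have hx₁ : ϖ ∣ x₁ := by
    refine hp.dvd_of_dvd_pow (n := 3) ((mul_dvd_mul_iff_left (pow_ne_zero 3 hϖ0)).mp ?_)
    exact ⟨y₂ ^ 2 + α * x₁ * y₂ + ϖ * γ * y₂ - β * x₁ ^ 2 - δ * x₁ - ϖ * ε,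
      by linear_combination -he⟩
  obtain ⟨x₂, rfl⟩ := hx₁
  have hy₂ : ϖ ∣ y₂ := by
    refine hp.dvd_of_dvd_pow (n := 2) ((mul_dvd_mul_iff_left (pow_ne_zero 4 hϖ0)).mp ?_)
    exact ⟨ϖ * x₂ ^ 3 + ϖ * β * x₂ ^ 2 + δ * x₂ + ε - α * x₂ * y₂ - γ * y₂,
      by linear_combination he⟩
  obtain ⟨y₃, rfl⟩ := hy₂
  exact ⟨⟨x₂, by ring⟩, ⟨y₃, by ring⟩⟩

/-- **The descent for type `II*`.** If moreover `π⁴ ∣ a₄`, the equation at a point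
`(π²x₂, π³y₃)` divided by `π⁵` shows `π ∣ a₆/π⁵`, i.e. `π⁶ ∣ a₆`. [folklore] -/
theorem dvd_a₆_of_equation_IIstar {ϖ : R} (hϖ : Irreducible ϖ) {V : WeierstrassCurve R}
    (h1 : ϖ ∣ V.a₁) (h2 : ϖ ^ 2 ∣ V.a₂) (h3 : ϖ ^ 3 ∣ V.a₃) (h4 : ϖ ^ 4 ∣ V.a₄)
    (h6 : ϖ ^ 5 ∣ V.a₆) {x y : R} (he : V.toAffine.Equation x y) (hx : ϖ ∣ x) (hy : ϖ ∣ y) :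
    ϖ ^ 6 ∣ V.a₆ := by
  have hϖ0 : ϖ ≠ 0 := hϖ.ne_zero
  obtain ⟨⟨x₂, rfl⟩, ⟨y₃, rfl⟩⟩ :=
    dvd_of_equation_deep hϖ h1 h2 h3 ((pow_dvd_pow ϖ (by norm_num)).trans h4) h6 he hx hy
  obtain ⟨α, hα⟩ := h1
  obtain ⟨β, hβ⟩ := h2
  obtain ⟨γ, hγ⟩ := h3
  obtain ⟨δ, hδ⟩ := h4
  obtain ⟨ε, hε⟩ := h6
  rw [WeierstrassCurve.Affine.equation_iff] at he
  simp only [hα, hβ, hγ, hδ, hε] at he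
  have hε' : ϖ ∣ ε := by
    refine (mul_dvd_mul_iff_left (pow_ne_zero 5 hϖ0)).mp ?_
    exact ⟨y₃ ^ 2 + α * x₂ * y₃ + γ * y₃ - x₂ ^ 3 - β * x₂ ^ 2 - δ * x₂,
      by linear_combination -he⟩
  obtain ⟨ε', rfl⟩ := hε'
  exact ⟨ε', by rw [hε]; ring⟩

/-! ### Every point has nonsingular reduction -/

/-- **Type `II`: integral points reduce to nonsingular points** (Silverman, *ATAEC*, IV.9.4
Step 3 with Lemma 9.5(b), PDF pp. 344, 347). [cite: SilvermanATAEC1994, IV.9.4 Step 3] -/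
theorem nonsingular_residue_of_kodairaSymbolOfMinimal_eq_II [PerfectField (ResidueField R)]
    (V : WeierstrassCurve R) (hV : V.kodairaSymbolOfMinimal = .II) {a b : R}
    (he : V.toAffine.Equation a b) :
    (V.map (residue R)).toAffine.Nonsingular (residue R a) (residue R b) := by
  by_contra hns
  obtain ⟨hΔ, -, ha₆⟩ := kodairaSymbolOfMinimal_eq_II_imp V hV
  have hex := exists_variableChange_step2_of_perfectField V hΔ
  obtain ⟨-, h3, h4, h6⟩ := hex.choose_spec
  set C := hex.choose
  rw [show normalizeStep2 V = C • V from dif_pos hex] at ha₆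
  have he' : (C • V).toAffine.Equation (C.toX a) (C.toY a b) :=
    (WeierstrassCurve.VariableChange.equation_iff V C a b).mpr he
  obtain ⟨ha, hb⟩ :=
    mem_maximalIdeal_of_not_nonsingular h3 h4 h6 he' (not_nonsingular_smul C hns)
  exact ha₆ (a₆_mem_sq_of_equation h3 h4 he' ha hb)

/-- **Type `II*`: integral points reduce to nonsingular points** (Silverman, *ATAEC*, IV.9.4
Step 10, PDF p. 346). [cite: SilvermanATAEC1994, IV.9.4 Step 10] -/
theorem nonsingular_residue_of_kodairaSymbolOfMinimal_eq_IIstar [PerfectField (ResidueField R)]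
    (V : WeierstrassCurve R) (hV : V.kodairaSymbolOfMinimal = .IIstar) {a b : R}
    (he : V.toAffine.Equation a b) :
    (V.map (residue R)).toAffine.Nonsingular (residue R a) (residue R b) := by
  by_contra hns
  obtain ⟨D, h1, h2, h3, h4, h6, h6'⟩ := exists_smul_of_kodairaSymbolOfMinimal_eq_IIstar V hV
  have he' : (D • V).toAffine.Equation (D.toX a) (D.toY a b) :=
    (WeierstrassCurve.VariableChange.equation_iff V D a b).mpr he
  have h3' : (D • V).a₃ ∈ maximalIdeal R := Ideal.pow_le_self three_ne_zero h3
  have h4' : (D • V).a₄ ∈ maximalIdeal R := Ideal.pow_le_self four_ne_zero h4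
  have h6'' : (D • V).a₆ ∈ maximalIdeal R := Ideal.pow_le_self (by norm_num) h6
  obtain ⟨ha, hb⟩ :=
    mem_maximalIdeal_of_not_nonsingular h3' h4' h6'' he' (not_nonsingular_smul D hns)
  apply h6'
  rw [mem_maximalIdeal_pow_iff_dvd] at h2 h3 h4 h6 ⊢
  rw [mem_maximalIdeal_iff_dvd] at h1 ha hb
  exact dvd_a₆_of_equation_IIstar irreducible_uniformizer h1 h2 h3 h4 h6 he' ha hb

variable {K : Type*} [Field K] [Algebra R K] [IsFractionRing R K]

/-- For types `II` and `II*` every `K`-point of `V ⊗ K` has nonsingular reduction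
(`E₀(K) = E(K)`, i.e. `c = 1`). [cite: SilvermanATAEC1994, IV.9.4 Steps 3 and 10] -/
theorem hasNonsingularReduction_of_kodairaSymbolOfMinimal [PerfectField (ResidueField R)]
    (V : WeierstrassCurve R)
    (hV : V.kodairaSymbolOfMinimal = .II ∨ V.kodairaSymbolOfMinimal = .IIstar)
    (P : (V.baseChange K).toAffine.Point) : V.HasNonsingularReduction P := by
  have hv := integers_valuationRing_valuation R K
  rcases point_cases hv P with rfl | ⟨x, y, h, rfl, hx⟩ | ⟨a, b, h, rfl⟩
  · trivial
  · exact Or.inl ((not_mem_range_iff hv).mpr hx)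
  · refine (WeierstrassCurve.hasNonsingularReduction_some_algebraMap_iff
      (IsFractionRing.injective R K) h).mpr ?_
    have he : V.toAffine.Equation a b :=
      (WeierstrassCurve.Affine.map_equation _ (IsFractionRing.injective R K) a b).mp h.left
    rcases hV with hV | hV
    · exact nonsingular_residue_of_kodairaSymbolOfMinimal_eq_II V hV he
    · exact nonsingular_residue_of_kodairaSymbolOfMinimal_eq_IIstar V hV he

/-- For types `II` and `II*`, `[E(K) : E₀(K)] = 1` for an `R`-minimal equation `M` over `K`
(`E₀ = goodReductionSubgroup` of `Tamagawa.lean`). [cite: SilvermanATAEC1994, IV.9.4 Steps 3, 10] -/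
theorem index_goodReductionSubgroup_eq_one [PerfectField (ResidueField R)]
    (M : WeierstrassCurve K) [M.IsMinimal R]
    (hM : (M.integralModel R).kodairaSymbolOfMinimal = .II ∨
      (M.integralModel R).kodairaSymbolOfMinimal = .IIstar) :
    (M.goodReductionSubgroup R).index = 1 := by
  obtain ⟨I, rfl⟩ : ∃ I : WeierstrassCurve R, M = I.baseChange K :=
    WeierstrassCurve.IsIntegral.integral
  rw [WeierstrassCurve.integralModel_baseChange_eq] at hM
  rw [WeierstrassCurve.goodReductionSubgroup_baseChange_eq, AddSubgroup.index_eq_one, eq_top_iff]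
  intro P _
  exact (WeierstrassCurve.mem_nonsingularReductionSubgroup_iff _).mpr
    (hasNonsingularReduction_of_kodairaSymbolOfMinimal I hM P)

end LocalIndex

/-! ### The discharges -/

section Discharge

open IsDedekindDomain

variable {A : Type*} [CommRing A] [IsDedekindDomain A] {K : Type*} [Field K] [Algebra A K]
  [IsFractionRing A K] (v : HeightOneSpectrum A) (W : WeierstrassCurve K)

/-- **Discharge of `localTamagawaNumber_eq_one_of_kodairaSymbolAt_eq_II`**: `c_v = 1` for type
`II` (Silverman, *ATAEC*, IV.9.4 Step 3, PDF p. 344), by the elementary argument of this file.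
[cite: SilvermanATAEC1994, IV.9.4 Step 3 (PDF p. 344)] -/
theorem localTamagawaNumber_eq_one_of_kodairaSymbolAt_eq_II_holds :
    localTamagawaNumber_eq_one_of_kodairaSymbolAt_eq_II v W := by
  intro _ _ hk
  rw [WeierstrassCurve.kodairaSymbolAt_def] at hk
  exact LocalIndex.index_goodReductionSubgroup_eq_one (W.localMinimalModel v) (Or.inl hk)

/-- **Discharge of `localTamagawaNumber_eq_one_of_kodairaSymbolAt_eq_IIstar`**: `c_v = 1` for
type `II*` (Silverman, *ATAEC*, IV.9.4 Step 10, PDF p. 346), by the elementary argument of this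
file. [cite: SilvermanATAEC1994, IV.9.4 Step 10 (PDF p. 346)] -/
theorem localTamagawaNumber_eq_one_of_kodairaSymbolAt_eq_IIstar_holds :
    localTamagawaNumber_eq_one_of_kodairaSymbolAt_eq_IIstar v W := by
  intro _ _ hk
  rw [WeierstrassCurve.kodairaSymbolAt_def] at hk
  exact LocalIndex.index_goodReductionSubgroup_eq_one (W.localMinimalModel v) (Or.inr hk)

end Discharge

end Literature.NumberTheory.EllipticCurves

end
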